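import Summits.ABC.IUTFork.Joshi.ATS4InitialThetaDataExistenceProofs
import Summits.ABC.IUTFork.Joshi.ATS4InitialThetaDataExistenceModel
import HarnessLib

/-!
# [J-IV] Theorem 5.7.1, conclusion read at Mochizuki's `F_mod`-model — HOLDS (PROOF-ONLY composition of the T-28 files)

Proof-only file of the abc-iut cell, block E (rung LADDER-ABC:A2.E; seat abc-iut-E-t28, slot T-28). SOURCE: K. Joshi, *Construction of Arithmetic
Teichmüller Spaces IV*, arXiv:2403.10430v2 («Preliminary version for comments», UNREFEREED) = [J-IV], Thm. 5.7.1 p.53 l.31–45. Composes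
`thm571Conditions_holds` (`ATS4InitialThetaDataExistenceProofs.lean`: the printed proof §5.8 in the tree's [IUTchIV] Cor. 2.2 vocabulary — Northcott,
Prop. 5.6.1 = `Cor22.partI_holds`, Lem. 5.8.7 = `Cor22.PrimeChoiceData.exists_prime_P1_P2_P3` with Joshi's `δ = d*_mod`, (P2)(P5)(P6) with the tree's
`Cor22.fullGaloisImage_holds`) with `thm571Mod_of_conditions` (`ATS4InitialThetaDataExistenceModel.lean`: (P7) in the arithmetic, E-t6's
`ATS3.InitialThetaData.nonempty_at`). RESULT: **`thm571Mod_holds : Thm571With lem587Window HasInitialThetaDataMod`** — for every compactly bounded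
`Z ⊆ U(Q̄)` whose support contains `2` and which satisfies (5.6.2) and every `d ≥ 1` there is a finite `Exc ⊆ U(Q̄)_{≤d}` such that every
`x_λ ∈ Z ∩ U(Q̄)_{≤d} ∖ Exc` admits a prime `ℓ` with `Q^{1/2} ≤ ℓ ≤ 10·δ·Q^{1/2}·log(2·δ·Q)` (`Q = Tate(C_λ)`, `δ = d*_mod(λ)`, Lem. 5.8.7 (1)) for which
Joshi's Initial Theta Data [J-III §3.1, §3.3] (E-t6's `ATS3.InitialThetaData`) EXIST at `(F_mod(√−1, W[2·3·5]), F(E_F[ℓ]), F̄, W ⊗ F, ℓ)`, `W` the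
`F_mod = ℚ(j_λ)`-model — unconditionally, classically (no Θ-link, no [IUTchIV] Theorem 1.10, nothing of [IUTchIII]). What separates this from the
AS-PRINTED `Thm571` is recorded in the companions: flag (a) (the printed window «`log(2·δ·log(Q))`» has one logarithm more than Lem. 5.8.7 (1)) and
flag (f)/N1 (Legendre model over an arbitrary theta field vs the `F_mod`-model). TAKES NO SIDE on [IUTchIII] Cor. 3.12, on Joshi's claims, or on
Mochizuki's reports on them; NO abc claim. [claim: Joshi2024ATS4, status: disputed] [claim: Mochizuki2012, status: disputed]
-/

noncomputable section

open Literature.NumberTheory.DiophantineGeometry.GenEll Literature.IUT.LogVolume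

namespace Summit.ABC.IUTFork.Joshi.ATS4

/-- **[J-IV] Theorem 5.7.1 (Lem-5.8.7 window, Joshi's `δ`; conclusion = Joshi's Initial Theta Data EXIST at the `F_mod`-model) HOLDS** — PROVED,
unconditionally: `thm571Mod_of_conditions thm571Conditions_holds`. [claim: Joshi2024ATS4, status: disputed] -/
theorem thm571Mod_holds : Thm571With lem587Window HasInitialThetaDataMod :=
  thm571Mod_of_conditions thm571Conditions_holds

/-- The same with Mochizuki's (C1) window as well: for `x_λ ∈ Z ∩ U(Q̄)_{≤d} ∖ Exc` the prime `ℓ` also satisfies `(log(q^∀))^{1/2} ≤ ℓ ≤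
10·δ_d·(log(q^∀))^{1/2}·log(2·δ_d·log(q^∀))`, `δ_d = 2^12·3^3·5·d` (first two conjuncts of `Cor22.ConditionsC1C2`; Joshi's window is the narrower one,
`conditionC1_of_lem587Window`). PROVED. [claim: Joshi2024ATS4, status: disputed] -/
theorem thm571Mod_conditionC1 (Z : CBData) (h2 : Z.SupportContains {2}) (h562 : Cond562 Z) {d : ℕ} (hd : 1 ≤ d) :
    ∃ Exc : Set NFPoint, HasFinitelyManyPoints Exc ∧ Exc ⊆ UPle d ∧
      ∀ P ∈ Z.toSet ∩ UPle d, P ∉ Exc → ∃ ℓ : ℕ, ℓ.Prime ∧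
        (Real.sqrt (Cor22.logQForall P) ≤ ℓ ∧
          (ℓ : ℝ) ≤ 10 * Cor22.delta d * Real.sqrt (Cor22.logQForall P) * Real.log (2 * Cor22.delta d * Cor22.logQForall P)) ∧
        HasInitialThetaDataMod P ℓ := by
  obtain ⟨Exc, hfin, hsub, hmain⟩ := thm571Mod_holds Z h2 h562 d hd
  refine ⟨Exc, hfin, hsub, fun P hP hPexc => ?_⟩
  obtain ⟨ℓ, hℓ, hW, hI⟩ := hmain P hP hPexc
  exact ⟨ℓ, hℓ, conditionC1_of_lem587Window hP.2 hℓ.one_lt.le hW, hI⟩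

end Summit.ABC.IUTFork.Joshi.ATS4

end
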